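import Summits.CriticalPhenomena.PercolationContinuityZ3.Theorems.PercNearOneGluingNoHeavyRsw3AnnulusBKCovering
import HarnessLib

/-!
# RSW3 lane (P2, method "3D RSW-lite from continuity"): the BLOCK mean-field bound at `p_c` —
# `Σ_g P_{p_c}(Λ(L) ↔ Λ_g(L) in Λ(N)) ≥ 1` over the exit blocks `Λ_g(L)` of the sphere `‖x‖∞ = N`

builds on p205010 (kernel theorem, internal audit signed; external expert review pending)

Cell `prim-rsw3` (post-continuity programme, LANE 3 "box crossing / quasi-multiplicativity at
`p_c(ℤ³)`"), prover seat `prim-rsw3-p2` (gen 2), memo `run/shared/lean/prim/rsw3/P2-RSWLITE.md` §7.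
Support file (`--supports stmt-CriticalPhenomena-4575`); no definitions, no named facts, no sorries.

Notation as in `…Rsw3AnnulusBKCovering`: `u_p(L,N) = P_p(Λ(L) ↔ ∂ⁱⁿΛ(N) in Λ(N))`,
`ψ_p(L,N) = Σ_{k ∈ ∂ⁱⁿΛ(⌊(N+L)/(2L+1)⌋)} P_p(Λ(L) ↔ Λ_{(2L+1)k}(L) in Λ(N))` (sum over the exit blocks of
the sphere `‖x‖∞ = N`, at most `2d (4N/L)^{d-1}` of them), and the BK decoupling
`u_p(L,R) ≤ ψ_p(L,N) · u_p(L, R-(N+L+1))` (`Rsw3.real_boxCrossing_le_psi_mul`).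

* `real_boxCrossing_iter_le_psi` — iterating, `u_p(L,(k+1)(N+2L+1)) ≤ ψ_p(L,N)^k u_p(L,N)`.
* `theta_eq_zero_of_psi_lt_one` — **block mean-field criterion (all `p`, all `d`)**: `ψ_p(L,N) < 1`
  for one pair `L ≤ N`, `N ≥ 1`, forces `θ(p) = 0`.
* `one_le_psi_criticalProbI` — **at `p_c(ℤ^d)`, `d ≥ 2`, for all `L ≤ N`, `N ≥ 1`: `ψ_{p_c}(L,N) ≥ 1`**
  (`ψ_p` is a polynomial in `p`; `θ > 0` above `p_c`).  With the inner box a point this is the tree's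
  `Σ_{x ∈ ∂Λ(N)} P_{p_c}(0 ↔ x in Λ(N)) ≥ 1` (Duminil-Copin–Tassion's `φ_{p_c}(Λ_N) ≥ 1`, `DCT16`); here the
  sum runs over `(N/L)^{d-1}` BLOCKS instead of `N^{d-1}` points, which is what makes it uniform in `L`.
* `exists_le_real_linked_exitBlock_criticalProbI` — hence SOME exit block is reached from `Λ(L)` inside
  `Λ(N)`: `∃ k ∈ ∂ⁱⁿΛ(K'), (2d)⁻¹ (L/4N)^{d-1} ≤ P_{p_c}(Λ(L) ↔ Λ_{(2L+1)k}(L) in Λ(N))` (`1 ≤ L ≤ N`) — a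
  box-to-box connection bound at every aspect ratio, uniform in the scale.

The companion file `…Rsw3AnnulusSqrtWindow` turns `ψ_{p_c} ≥ 1` into the square-root improvement
`u_{p_c}(L,N) ≥ (2d)^{-1/2} (L/16N)^{(d-1)/2}` of the aspect window of `…Rsw3AnnulusAspectWindow`
(`(2d)⁻¹ (L/4N)^{d-1}`), exactly as `φ_{p_c} ≥ 1` plus BK improves Hammersley's `π_{p_c}(n) ≥ c n^{-(d-1)}`
to `c n^{-(d-1)/2}` (`CriticalOneArmBKLowerBound`).

References: H. Duminil-Copin, V. Tassion, Comm. Math. Phys. 343 (2016) 725–745, §1 (`φ_p(S)`,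
`φ_{p_c}(Λ_n) ≥ 1`); H. Kesten, *Percolation Theory for Mathematicians* (1982), Thm. 5.1, Cor. 5.1;
J. van den Berg, H. Kesten, J. Appl. Probab. 22 (1985) 556–569. [folklore]
-/

noncomputable section

namespace Summit.CriticalPhenomena.PercolationContinuityZ3.Theorems

open MeasureTheory ProbabilityTheory Filter Topology
open Literature.Probability.Percolation Literature.Probability.LatticeModels
open Literature.Probability.Percolation.CerfDembinVanishing
open scoped Literature.Probability.Percolation

namespace Rsw3

open SurfaceTension Crossing

variable {d : ℕ}

/-! ## Iteration and the block mean-field criterion -/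

/-- **Iterated BK decoupling.** With `s = N + 2L + 1`: `u_p(L,(k+1)s) ≤ ψ_p(L,N)^k · u_p(L,N)`. -/
theorem real_boxCrossing_iter_le_psi (p : unitInterval) {L N : ℕ} (hLN : L ≤ N) (hN : 1 ≤ N) (k : ℕ) :
    (bondPercolation (zdGraph d) p).real (boxCrossing d L ((k + 1) * (N + 2 * L + 1))) ≤
      (∑ k ∈ innerBoundary (zdGraph d) (box d ((N + L) / (2 * L + 1))),
          (bondPercolation (zdGraph d) p).real
            (linked (↑(box d N) : Set (Site d)) (sbox (gridPt L k) L) ↑(box d L))) ^ k *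
        (bondPercolation (zdGraph d) p).real (boxCrossing d L N) := by
  set μ := bondPercolation (zdGraph d) p with hμ
  set s := N + 2 * L + 1 with hs
  set ψ := ∑ k ∈ innerBoundary (zdGraph d) (box d ((N + L) / (2 * L + 1))),
      μ.real (linked (↑(box d N) : Set (Site d)) (sbox (gridPt L k) L) ↑(box d L)) with hψ
  have hψ0 : 0 ≤ ψ := Finset.sum_nonneg fun _ _ => measureReal_nonneg
  induction k with
  | zero =>
    have hanti : μ.real (boxCrossing d L (1 * s)) ≤ μ.real (boxCrossing d L N) :=
      measureReal_mono (fun ω hω => boxCrossing_anti hLN (by rw [one_mul, hs]; omega) hω)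
    simpa using hanti
  | succ k ih =>
    have hks : s ≤ (k + 1) * s := Nat.le_mul_of_pos_left s (by omega)
    have hR : N + 2 * L + 1 ≤ (k + 1 + 1) * s := by
      have : s ≤ (k + 1 + 1) * s := Nat.le_mul_of_pos_left s (by omega)
      simpa only [hs] using this
    have hstep := real_boxCrossing_le_psi_mul (d := d) p hLN hN hR
    have hsub : (k + 1 + 1) * s - (N + L + 1) = (k + 1) * s + L := by
      have h1 : (k + 1 + 1) * s = (k + 1) * s + s := by ring
      rw [h1, hs]
      omega
    rw [hsub] at hstep
    have hLks : L ≤ (k + 1) * s := le_trans (by omega) hks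
    have hanti : μ.real (boxCrossing d L ((k + 1) * s + L)) ≤
        μ.real (boxCrossing d L ((k + 1) * s)) :=
      measureReal_mono (fun ω hω => boxCrossing_anti hLks (Nat.le_add_right _ _) hω)
    calc μ.real (boxCrossing d L ((k + 1 + 1) * s))
        ≤ ψ * μ.real (boxCrossing d L ((k + 1) * s + L)) := hstep
      _ ≤ ψ * μ.real (boxCrossing d L ((k + 1) * s)) := mul_le_mul_of_nonneg_left hanti hψ0
      _ ≤ ψ * (ψ ^ k * μ.real (boxCrossing d L N)) := mul_le_mul_of_nonneg_left ih hψ0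
      _ = ψ ^ (k + 1) * μ.real (boxCrossing d L N) := by ring

/-- **Block mean-field criterion (all `p`, all `d`).** If `ψ_p(L,N) < 1` for one pair `L ≤ N`,
`1 ≤ N`, then `θ(p) = 0`. [cite: Kesten1982, Thm. 5.1] -/
theorem theta_eq_zero_of_psi_lt_one (p : unitInterval) {L N : ℕ} (hLN : L ≤ N) (hN : 1 ≤ N)
    (h : ∑ k ∈ innerBoundary (zdGraph d) (box d ((N + L) / (2 * L + 1))),
          (bondPercolation (zdGraph d) p).real
            (linked (↑(box d N) : Set (Site d)) (sbox (gridPt L k) L) ↑(box d L)) < 1) :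
    theta (zdGraph d) 0 p = 0 := by
  set ψ := ∑ k ∈ innerBoundary (zdGraph d) (box d ((N + L) / (2 * L + 1))),
      (bondPercolation (zdGraph d) p).real
        (linked (↑(box d N) : Set (Site d)) (sbox (gridPt L k) L) ↑(box d L)) with hψ
  set u : ℝ := (bondPercolation (zdGraph d) p).real (boxCrossing d L N) with hu
  have hψ0 : 0 ≤ ψ := Finset.sum_nonneg fun _ _ => measureReal_nonneg
  have hpow : Tendsto (fun k : ℕ => ψ ^ k * u) atTop (𝓝 0) := by
    simpa using (tendsto_pow_atTop_nhds_zero_of_lt_one hψ0 h).mul_const u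
  have hθ : ∀ k : ℕ, theta (zdGraph d) 0 p ≤ ψ ^ k * u := fun k =>
    calc theta (zdGraph d) 0 p
        ≤ (bondPercolation (zdGraph d) p).real (boxCrossing d L ((k + 1) * (N + 2 * L + 1))) :=
          theta_le_real_boxCrossing p (le_trans hLN (by nlinarith))
      _ ≤ ψ ^ k * u := real_boxCrossing_iter_le_psi p hLN hN k
  have hle : theta (zdGraph d) 0 p ≤ 0 := ge_of_tendsto' hpow hθ
  have hθ0 : 0 ≤ theta (zdGraph d) 0 p := measureReal_nonneg
  linarith

/-! ## At `p_c`: `ψ_{p_c}(L,N) ≥ 1` -/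

/-- **The block mean-field bound at `p_c(ℤ^d)`, `d ≥ 2`:** for all `L ≤ N`, `1 ≤ N`,
`Σ_{k ∈ ∂ⁱⁿΛ(⌊(N+L)/(2L+1)⌋)} P_{p_c}(Λ(L) ↔ Λ_{(2L+1)k}(L) in Λ(N)) ≥ 1` — the block analogue of
`φ_{p_c}(Λ_N) ≥ 1`. [cite: Kesten1982, Cor. 5.1] -/
theorem one_le_psi_criticalProbI (hd : 2 ≤ d) {L N : ℕ} (hLN : L ≤ N) (hN : 1 ≤ N) :
    1 ≤ ∑ k ∈ innerBoundary (zdGraph d) (box d ((N + L) / (2 * L + 1))),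
          (bondPercolation (zdGraph d) (criticalProbI d)).real
            (linked (↑(box d N) : Set (Site d)) (sbox (gridPt L k) L) ↑(box d L)) := by
  classical
  set G := innerBoundary (zdGraph d) (box d ((N + L) / (2 * L + 1))) with hG
  set Ψ : unitInterval → ℝ := fun p => ∑ k ∈ G, (bondPercolation (zdGraph d) p).real
      (linked (↑(box d N) : Set (Site d)) (sbox (gridPt L k) L) ↑(box d L)) with hΨ
  by_contra hlt
  push Not at hlt
  have h1 : Ψ (criticalProbI d) < 1 := hlt
  -- continuity of `p ↦ ψ_p(L,N)` at `p_c`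
  have hcont : Continuous Ψ :=
    continuous_finsetSum _ fun k _ => continuous_real_linked (box d N) _ _
  obtain ⟨δ, hδ, hball⟩ := Metric.continuous_iff.1 hcont (criticalProbI d)
    (1 - Ψ (criticalProbI d)) (by linarith)
  -- a parameter slightly above `p_c`
  have hpc1 : criticalProb (zdGraph d) (0 : Site d) < 1 := criticalProb_zd_lt_one hd
  have hpc0 : 0 ≤ criticalProb (zdGraph d) (0 : Site d) := (criticalProb_mem_Icc _ _).1
  set t : ℝ := min (criticalProb (zdGraph d) (0 : Site d) + δ / 2) 1 with ht
  have htI : t ∈ Set.Icc (0 : ℝ) 1 := ⟨le_min (by linarith) zero_le_one, min_le_right _ _⟩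
  obtain ⟨p, hp⟩ : ∃ p : unitInterval, (p : ℝ) = t := ⟨⟨t, htI⟩, rfl⟩
  have hlt' : criticalProb (zdGraph d) (0 : Site d) < (p : ℝ) := by
    rw [hp]; exact lt_min (by linarith) hpc1
  have hle' : (p : ℝ) ≤ criticalProb (zdGraph d) (0 : Site d) + δ / 2 := by
    rw [hp]; exact min_le_left _ _
  have hdist : dist p (criticalProbI d) < δ := by
    rw [Subtype.dist_eq, Real.dist_eq, coe_criticalProbI, abs_of_pos (sub_pos.2 hlt')]
    linarith
  have hnear := hball p hdist
  rw [Real.dist_eq] at hnear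
  have hp1 : Ψ p < 1 := by
    have := (abs_sub_lt_iff.1 hnear).1
    linarith
  have hθ0 := theta_eq_zero_of_psi_lt_one p hLN hN hp1
  have hθpos := theta_pos_of_criticalProb_lt_holds (zdGraph d) 0 p hlt'
  linarith

/-- **Some exit block is reached from `Λ(L)` inside `Λ(N)` with probability `≥ (2d)⁻¹ (L/4N)^{d-1}`**
(`d ≥ 2`, `1 ≤ L ≤ N`): a box-to-box connection bound at every aspect ratio, uniform in the scale.
[cite: Kesten1982, Cor. 5.1] -/
theorem exists_le_real_linked_exitBlock_criticalProbI (hd : 2 ≤ d) {L N : ℕ} (hL : 1 ≤ L)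
    (hLN : L ≤ N) :
    ∃ k ∈ innerBoundary (zdGraph d) (box d ((N + L) / (2 * L + 1))),
      (2 * (d : ℝ))⁻¹ * ((L : ℝ) / (4 * N)) ^ (d - 1) ≤
        (bondPercolation (zdGraph d) (criticalProbI d)).real
          (linked (↑(box d N) : Set (Site d)) (sbox (gridPt L k) L) ↑(box d L)) := by
  classical
  set G := innerBoundary (zdGraph d) (box d ((N + L) / (2 * L + 1))) with hG
  set C : ℝ := 2 * d * (4 * (N : ℝ) / L) ^ (d - 1) with hC
  have hL0 : (0 : ℝ) < L := by exact_mod_cast hL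
  have hN0 : (0 : ℝ) < N := by exact_mod_cast (lt_of_lt_of_le hL hLN)
  have hCpos : 0 < C := by positivity
  have hCinv : (2 * (d : ℝ))⁻¹ * ((L : ℝ) / (4 * N)) ^ (d - 1) = C⁻¹ := by
    rw [← inv_div (4 * (N : ℝ)) L, inv_pow, ← mul_inv]
  rw [hCinv]
  have hsum : 1 ≤ ∑ k ∈ G, (bondPercolation (zdGraph d) (criticalProbI d)).real
      (linked (↑(box d N) : Set (Site d)) (sbox (gridPt L k) L) ↑(box d L)) :=
    one_le_psi_criticalProbI hd hLN (le_trans hL hLN)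
  have hcard : (G.card : ℝ) ≤ C := card_innerBoundary_gridBox_le' hL hLN
  by_contra hno
  push Not at hno
  have hne : G.Nonempty := by
    by_contra hempty
    rw [Finset.not_nonempty_iff_eq_empty] at hempty
    rw [hempty, Finset.sum_empty] at hsum
    linarith
  have hlt : ∑ k ∈ G, (bondPercolation (zdGraph d) (criticalProbI d)).real
      (linked (↑(box d N) : Set (Site d)) (sbox (gridPt L k) L) ↑(box d L)) < ∑ _k ∈ G, C⁻¹ :=
    Finset.sum_lt_sum_of_nonempty hne fun k hk => hno k hk
  rw [Finset.sum_const, nsmul_eq_mul] at hlt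
  have : (G.card : ℝ) * C⁻¹ ≤ 1 := by
    rw [← div_eq_mul_inv, div_le_one hCpos]; exact hcard
  linarith

end Rsw3

end Summit.CriticalPhenomena.PercolationContinuityZ3.Theorems

end
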